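import Literature.AlgebraicGeometry.Motives.HodgeStructureAbelianTypeTensor
import Literature.AlgebraicGeometry.Motives.HodgeStructureAbelianTypeDual
import HarnessLib

/-!
# The tensor spaces `T^{a,b} H = H^{⊗ a} ⊗ (H^∨)^{⊗ b}` of a Hodge structure of abelian type are of abelian type

Family `hodge`, layer `Literature/AlgebraicGeometry/Motives`. THEOREMS only (no definition, no
named fact; net debt 0): the corollary of the closure of Hodge structures of abelian type under
tensor powers (`IsOfAbelianType.tensorPower`, `Motives/HodgeStructureAbelianTypeTensorPower`),
duals (`IsOfAbelianType.dual`, `Motives/HodgeStructureAbelianTypeDual`) and binary tensor products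
(`IsOfAbelianType.tensor`, `Motives/HodgeStructureAbelianTypeTensor`) for the tree's tensor spaces
`HodgeStructure.tensorSpace H a b = ((H^{⊗ a}) ⊗ ((H^∨)^{⊗ b})).cast _` (`Motives/HodgeTensor`;
Deligne, LNM 900, I §3.1) — the Hodge structures whose Hodge classes are the HODGE TENSORS
defining the tree's `HodgeStructure.hodgeGroup` / `mumfordTateGroup`.

Sources read verbatim. Y. André, *Pour une théorie inconditionnelle des motifs*
[Andre1996Motifs] (held text `paper:doi-10-1007-bf02698643`, PDF p. 27 = printed p. 30), §6.1:
"Ces motifs sont aussi les objets de la catégorie tannakienne `ℳ(𝒜b)_𝒱` engendrée par les `𝔥(A)`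
et les motifs d'Artin". B. Moonen, *Families of motives and the Mumford–Tate conjecture*
[Moonen2017FamiliesMotives] (held text `paper:doi-10-1007-s00032-017-0273-x`, p. 3), §2.1:
"This category `HS_ℚ` is a neutral Tannakian category; in particular we have direct sums, tensor
products and duals".

## What is proved

* **`IsOfAbelianType.tensorSpace`** — if `H` (finite-dimensional) is of abelian type then so is
  every `T^{a,b} H`;
* `isOfAbelianType_hodgeStructure_tensorSpace` — every `T^{a,b} Hᵏ(A(ℂ); ℚ)` of a complex abelian
  variety is of abelian type; `isOfAbelianType_abelianTensor_tensorSpace` — and every `T^{a,b}` of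
  a generator `(H¹(A)^{⊗ m})(c)`.
-/

noncomputable section

open scoped TensorProduct

namespace Literature.AlgebraicGeometry.Motives

namespace HodgeStructure

open Literature.AlgebraicTopology.SingularHomology

universe u

variable {V : Type u} [AddCommGroup V] [Module ℚ V] {w : ℤ}

/-- **The tensor spaces `T^{a,b} H = H^{⊗ a} ⊗ (H^∨)^{⊗ b}` of a Hodge structure of abelian type
are of abelian type** (`H^{⊗ a}` by `IsOfAbelianType.tensorPower`, `H^∨` by
`IsOfAbelianType.dual`, `⊗` by `IsOfAbelianType.tensor`, and the weight transport
`IsOfAbelianType.cast`): André's `ℳ(𝒜b)` is a Tannakian subcategory (§6.1), and on the Hodge side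
`HS_ℚ` has "tensor products and duals … given by the usual constructions" (Moonen §2.1); the
tensor spaces of Deligne, LNM 900, I §3.1 are built from these. [cite: Andre1996Motifs, §6.1 (p. 30)]
[cite: Moonen2017FamiliesMotives, §2.1 (p. 3)] -/
theorem IsOfAbelianType.tensorSpace [HodgeTensorFacts.{u, u}] [Module.Finite ℚ V]
    {H : HodgeStructure V w} (h : H.IsOfAbelianType) (a b : ℕ) :
    (H.tensorSpace a b).IsOfAbelianType :=
  ((h.tensorPower a).tensor (h.dual.tensorPower b)).cast _

section Instances

variable [HodgeTensorFacts.{0, 0}]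

/-- **Every tensor space `T^{a,b} Hᵏ(A(ℂ); ℚ)` of a complex abelian variety is of abelian type**
(`Hᵏ(A)` is, `isOfAbelianType_hodgeStructure`; `Hᵏ(A(ℂ); ℚ)` is finite-dimensional,
`finiteDimensional_bettiCohomology`). These are the Hodge structures carrying the Hodge tensors of
`Hᵏ(A)` (the tree's `HodgeStructure.hodgeGroup`). [cite: Andre1996Motifs, §6.1 (p. 30)] -/
theorem isOfAbelianType_hodgeStructure_tensorSpace (A : AbelianVariety ℂ)
    (hA : IsSmoothProjective A.dim A.X) (M : HodgeTheory.HodgeModel A.dim A.X)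
    (hM : M.IsHodgeSymmetric) (k a b : ℕ) :
    haveI : Module.Finite ℚ (singularCohomology ℚ ℚ (ComplexPoints A.X) k) :=
      HodgeTheory.finiteDimensional_bettiCohomology hA k
    ((M.hodgeStructure hA hM k).tensorSpace a b).IsOfAbelianType :=
  haveI : Module.Finite ℚ (singularCohomology ℚ ℚ (ComplexPoints A.X) k) :=
    HodgeTheory.finiteDimensional_bettiCohomology hA k
  (isOfAbelianType_hodgeStructure A hA M hM k).tensorSpace a b

/-- Tensor spaces `T^{a,b}` of the generators `(H¹(A)^{⊗ m})(c)` are of abelian type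
(finite-dimensionality from `IsOfAbelianType.finiteDimensional`). [cite: Andre1996Motifs, §6.1 (p. 30)] -/
theorem isOfAbelianType_abelianTensor_tensorSpace (A : AbelianVariety ℂ)
    (hA : IsSmoothProjective A.dim A.X) (M : HodgeTheory.HodgeModel A.dim A.X)
    (hM : M.IsHodgeSymmetric) (m : ℕ) (c : ℤ) (a b : ℕ) :
    haveI : Module.Finite ℚ (⨂[ℚ]^m (singularCohomology ℚ ℚ (ComplexPoints A.X) 1)) :=
      (isOfAbelianType_abelianTensor A hA M hM m c).finiteDimensional
    ((abelianTensor A hA M hM m c).tensorSpace a b).IsOfAbelianType :=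
  haveI : Module.Finite ℚ (⨂[ℚ]^m (singularCohomology ℚ ℚ (ComplexPoints A.X) 1)) :=
    (isOfAbelianType_abelianTensor A hA M hM m c).finiteDimensional
  (isOfAbelianType_abelianTensor A hA M hM m c).tensorSpace a b

end Instances

end HodgeStructure

end Literature.AlgebraicGeometry.Motives
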